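import Literature.Probability.Process.BrownianQuadraticSums
import Literature.Probability.Process.BrownianPair
import Mathlib.MeasureTheory.OuterMeasure.BorelCantelli
import Mathlib.Probability.Distributions.Gaussian.Real
import HarnessLib

/-!
# Dyadic quadratic variation of Brownian motion, and Gaussian exponentials of the pair

Trunk T-PROBABILITY (Literature/Probability/Process). Two elementary facts about the canonical
Brownian motion `brownian` on `(ℝ≥0 → ℝ, preWienerMeasure)` and the pair of independent Brownian
motions on `WienerPair` (`BrownianPair.lean`), in the form consumed by the discretisation proof of
the exponential-supermartingale bound for SDEs with additive noise (provefact unit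
`CuneoEckmannHairerReyBellet2018_pinnedChain`, CEHR Lemma 5.5):

* `brownianQuadSum t n` — the quadratic sum `∑_{k<n} (B_{(k+1)t/n} - B_{kt/n})²` over the uniform
  grid `gridTime t n k = k t/n`, and the centred partial sums `centredQuadSum`;
  `integral_sq_centredQuadSum` — `E[(∑_{k<m} ((Δ_k B)² - t/n))²] = 2 m (t/n)²`
  (orthogonality of the centred squared increments to the past, `BrownianQuadraticSums.lean`);
  `measure_le_abs_centredQuadSum_le` — the Chebyshev bound; and
  `ae_tendsto_brownianQuadSum_dyadic` — **`∑_{k<2^m} (Δ_k B)² → t` almost surely along the dyadic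
  grids** (Borel–Cantelli), the pathwise quadratic variation used to identify `∫ B dB`.
* `integral_exp_linear_pair`, `lintegral_exp_linear_pair_sub` — **the Gaussian exponential moment of
  the pair at a fixed time**: `E exp(u B¹_h + v B²_h) = exp((u² + v²) h / 2)`
  (independence of the coordinates and Mathlib's `mgf_gaussianReal`), also as
  `E exp(u B¹_h + v B²_h - (u²+v²)h/2) = 1` in `ℝ≥0∞` form.
* `measurable_comap_pairPast_brownian_fst/snd` — for `u ≤ s` the coordinates `B¹_u, B²_u` are
  measurable with respect to the past `σ(pairPast s)` of the pair.

## References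

* D. Revuz, M. Yor, *Continuous Martingales and Brownian Motion* (3rd ed., 1999), Ch. I Thm (2.4)
  (`∑ (Δ B)² → t` in `L²`; a.s. along partitions with summable mesh), Ch. I §1 (Gaussian laws).
* P. Lévy (1940); J. L. Doob, *Stochastic Processes* (1953), Ch. VIII §2 (a.s. dyadic quadratic
  variation). [folklore]
-/

noncomputable section

open MeasureTheory ProbabilityTheory Filter Topology Finset
open scoped NNReal ENNReal Topology

namespace Literature.Probability.Process

/-! ### Quadratic sums over uniform grids -/

/-- The grid time `s_k = k · t/n` of the uniform partition of `[0, t]` into `n` cells. [folklore] -/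
def gridTime (t : ℝ≥0) (n k : ℕ) : ℝ≥0 := (k : ℝ≥0) * (t / n)

/-- Grid times are monotone in the index. [folklore] -/
theorem gridTime_mono (t : ℝ≥0) (n : ℕ) {j k : ℕ} (h : j ≤ k) : gridTime t n j ≤ gridTime t n k :=
  mul_le_mul_of_nonneg_right (Nat.cast_le.2 h) (by positivity)

/-- `s_{k+1} - s_k = t/n`. [folklore] -/
theorem gridTime_succ_sub (t : ℝ≥0) (n k : ℕ) :
    (gridTime t n (k + 1) : ℝ) - gridTime t n k = (t : ℝ) / n := by
  simp only [gridTime, NNReal.coe_mul, NNReal.coe_natCast, NNReal.coe_div]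
  push_cast
  ring

/-- `s_0 = 0`. [folklore] -/
@[simp] theorem gridTime_zero (t : ℝ≥0) (n : ℕ) : gridTime t n 0 = 0 := by simp [gridTime]

/-- `s_n = t` (`n ≠ 0`). [folklore] -/
theorem gridTime_self (t : ℝ≥0) {n : ℕ} (hn : n ≠ 0) : gridTime t n n = t := by
  rw [gridTime, mul_div_cancel₀ _ (Nat.cast_ne_zero.2 hn)]

/-- The **quadratic sum** `∑_{k<n} (B_{s_{k+1}} - B_{s_k})²` of the canonical Brownian motion over
the uniform grid of `[0, t]` with `n` cells. Revuz–Yor (1999), Ch. I Thm (2.4). [folklore] -/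
def brownianQuadSum (t : ℝ≥0) (n : ℕ) (ω : ℝ≥0 → ℝ) : ℝ :=
  ∑ k ∈ range n, (brownian (gridTime t n (k + 1)) ω - brownian (gridTime t n k) ω) ^ 2

/-- The centred partial sums `S_m = ∑_{k<m} ((Δ_k B)² - t/n)`. [folklore] -/
def centredQuadSum (t : ℝ≥0) (n m : ℕ) (ω : ℝ≥0 → ℝ) : ℝ :=
  ∑ k ∈ range m, ((brownian (gridTime t n (k + 1)) - brownian (gridTime t n k)) ω ^ 2 -
    ((gridTime t n (k + 1) : ℝ) - gridTime t n k))

/-- `∑_{k<n} (Δ_k B)² - t = S_n` (`n ≠ 0`). [folklore] -/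
theorem brownianQuadSum_sub_eq (t : ℝ≥0) {n : ℕ} (hn : n ≠ 0) (ω : ℝ≥0 → ℝ) :
    brownianQuadSum t n ω - t = centredQuadSum t n n ω := by
  unfold brownianQuadSum centredQuadSum
  rw [sum_sub_distrib]
  congr 1
  simp only [gridTime_succ_sub, sum_const, card_range, nsmul_eq_mul]
  field_simp

/-- The centred partial sums are square integrable. [folklore] -/
theorem memLp_two_centredQuadSum (t : ℝ≥0) (n m : ℕ) : MemLp (centredQuadSum t n m) 2 preWienerMeasure := by
  unfold centredQuadSum
  have : (fun ω => ∑ k ∈ range m, ((brownian (gridTime t n (k + 1)) - brownian (gridTime t n k)) ω ^ 2 -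
      ((gridTime t n (k + 1) : ℝ) - gridTime t n k))) =
      ∑ k ∈ range m, fun ω => ((brownian (gridTime t n (k + 1)) - brownian (gridTime t n k)) ω ^ 2 -
        ((gridTime t n (k + 1) : ℝ) - gridTime t n k)) := by
    funext ω; simp
  rw [this]
  exact memLp_finsetSum' _ fun k _ => memLp_two_sqIncr _ _

/-- The centred partial sum `S_m` is `𝓕⁰_{s_m}`-strongly measurable. [folklore] -/
theorem stronglyMeasurable_centredQuadSum (t : ℝ≥0) (n m : ℕ) :
    StronglyMeasurable[RandomPlanarGeometry.brownianFiltration (gridTime t n m)] (centredQuadSum t n m) := by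
  unfold centredQuadSum
  have : (fun ω => ∑ k ∈ range m, ((brownian (gridTime t n (k + 1)) - brownian (gridTime t n k)) ω ^ 2 -
      ((gridTime t n (k + 1) : ℝ) - gridTime t n k))) =
      ∑ k ∈ range m, fun ω => ((brownian (gridTime t n (k + 1)) - brownian (gridTime t n k)) ω ^ 2 -
        ((gridTime t n (k + 1) : ℝ) - gridTime t n k)) := by
    funext ω; simp
  rw [this]
  refine Finset.stronglyMeasurable_sum _ fun k hk => ?_
  have hk' : k + 1 ≤ m := mem_range.1 hk
  exact (stronglyMeasurable_sqIncr (gridTime_mono t n (Nat.le_succ k))).mono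
    (RandomPlanarGeometry.brownianFiltration.mono (gridTime_mono t n hk'))

/-- **`E[S_m²] = 2 m (t/n)²`** for the centred partial sums (`m ≤ n` is not needed): induction on
`m`, the cross term `E[S_m ξ_m]` vanishing by orthogonality of the centred squared increment to the
past (`integral_mul_cellTerm_eq_zero`) and `E[ξ_m²] = 2 (t/n)²` (`integral_sqIncr_sq`).
Revuz–Yor (1999), Ch. I, proof of Thm (2.4). [folklore] -/
theorem integral_sq_centredQuadSum (t : ℝ≥0) (n : ℕ) :
    ∀ m, ∫ ω, centredQuadSum t n m ω ^ 2 ∂preWienerMeasure = 2 * m * ((t : ℝ) / n) ^ 2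
  | 0 => by simp [centredQuadSum]
  | m + 1 => by
    haveI := RandomPlanarGeometry.isProbabilityMeasure_preWienerMeasure'
    have ih := integral_sq_centredQuadSum t n m
    have hab : gridTime t n m ≤ gridTime t n (m + 1) := gridTime_mono t n (Nat.le_succ m)
    -- the last centred squared increment
    have hS : ∀ ω, centredQuadSum t n (m + 1) ω = centredQuadSum t n m ω +
        ((brownian (gridTime t n (m + 1)) - brownian (gridTime t n m)) ω ^ 2 -
          ((gridTime t n (m + 1) : ℝ) - gridTime t n m)) := fun ω => by
      simp only [centredQuadSum, sum_range_succ]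
    have hexp : ∀ ω, centredQuadSum t n (m + 1) ω ^ 2 =
        (centredQuadSum t n m ω ^ 2 + 2 * (centredQuadSum t n m ω * (1 * (1 : ℝ) ^ 2 *
          ((brownian (gridTime t n (m + 1)) - brownian (gridTime t n m)) ω ^ 2 -
            ((gridTime t n (m + 1) : ℝ) - gridTime t n m))))) +
        ((brownian (gridTime t n (m + 1)) - brownian (gridTime t n m)) ω ^ 2 -
          ((gridTime t n (m + 1) : ℝ) - gridTime t n m)) ^ 2 :=
      fun ω => by rw [hS]; ring
    simp_rw [hexp]
    have hS2 := memLp_two_centredQuadSum t n m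
    have hξ2 : MemLp (fun ω => (brownian (gridTime t n (m + 1)) - brownian (gridTime t n m)) ω ^ 2 -
        ((gridTime t n (m + 1) : ℝ) - gridTime t n m)) 2 preWienerMeasure := memLp_two_sqIncr _ _
    have hI1 : Integrable (fun ω => centredQuadSum t n m ω ^ 2) preWienerMeasure := hS2.integrable_sq
    have hI2 : Integrable (fun ω => centredQuadSum t n m ω * (1 * (1 : ℝ) ^ 2 *
        ((brownian (gridTime t n (m + 1)) - brownian (gridTime t n m)) ω ^ 2 -
          ((gridTime t n (m + 1) : ℝ) - gridTime t n m)))) preWienerMeasure := by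
      have h := hS2.integrable_mul hξ2
      refine h.congr (ae_of_all _ fun ω => ?_)
      simp only [Pi.mul_apply]
      ring
    have hI3 : Integrable (fun ω => ((brownian (gridTime t n (m + 1)) - brownian (gridTime t n m)) ω ^ 2 -
        ((gridTime t n (m + 1) : ℝ) - gridTime t n m)) ^ 2) preWienerMeasure := hξ2.integrable_sq
    have hI12 : Integrable (fun ω => centredQuadSum t n m ω ^ 2 + 2 * (centredQuadSum t n m ω * (1 * (1 : ℝ) ^ 2 *
        ((brownian (gridTime t n (m + 1)) - brownian (gridTime t n m)) ω ^ 2 -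
          ((gridTime t n (m + 1) : ℝ) - gridTime t n m))))) preWienerMeasure := hI1.add (hI2.const_mul 2)
    rw [integral_add hI12 hI3, integral_add hI1 (hI2.const_mul 2), integral_const_mul, ih]
    have hcross : ∫ ω, centredQuadSum t n m ω * (1 * (1 : ℝ) ^ 2 *
        ((brownian (gridTime t n (m + 1)) - brownian (gridTime t n m)) ω ^ 2 -
          ((gridTime t n (m + 1) : ℝ) - gridTime t n m))) ∂preWienerMeasure = 0 :=
      integral_mul_cellTerm_eq_zero (V := fun _ => (1 : ℝ)) (C := 1) (c := 1) hab stronglyMeasurable_const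
        (fun _ => by simp) (stronglyMeasurable_centredQuadSum t n m) hS2
    have hsq : ∫ ω, (((brownian (gridTime t n (m + 1)) - brownian (gridTime t n m)) ω ^ 2 -
        ((gridTime t n (m + 1) : ℝ) - gridTime t n m))) ^ 2 ∂preWienerMeasure =
        2 * ((gridTime t n (m + 1) : ℝ) - gridTime t n m) ^ 2 := integral_sqIncr_sq hab
    rw [hcross, hsq, gridTime_succ_sub]
    push_cast
    ring

/-- The centred sum is measurable. [folklore] -/
theorem measurable_centredQuadSum (t : ℝ≥0) (n m : ℕ) : Measurable (centredQuadSum t n m) :=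
  ((stronglyMeasurable_centredQuadSum t n m).mono (RandomPlanarGeometry.brownianFiltration.le _)).measurable

/-- **Chebyshev**: `P(ε ≤ |S_n|) ≤ 2 n (t/n)² / ε²` (`ε > 0`). [folklore] -/
theorem measure_le_abs_centredQuadSum_le (t : ℝ≥0) (n : ℕ) {ε : ℝ} (hε : 0 < ε) :
    preWienerMeasure {ω | ε ≤ |centredQuadSum t n n ω|} ≤
      ENNReal.ofReal (2 * n * ((t : ℝ) / n) ^ 2 / ε ^ 2) := by
  have hset : {ω | ε ≤ |centredQuadSum t n n ω|} ⊆
      {ω | ENNReal.ofReal (ε ^ 2) ≤ ENNReal.ofReal (centredQuadSum t n n ω ^ 2)} := by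
    intro ω hω
    simp only [Set.mem_setOf_eq] at hω ⊢
    refine ENNReal.ofReal_le_ofReal ?_
    calc ε ^ 2 ≤ |centredQuadSum t n n ω| ^ 2 := pow_le_pow_left₀ hε.le hω 2
      _ = centredQuadSum t n n ω ^ 2 := sq_abs _
  refine (measure_mono hset).trans ?_
  have hmeas : AEMeasurable (fun ω => ENNReal.ofReal (centredQuadSum t n n ω ^ 2)) preWienerMeasure :=
    ((measurable_centredQuadSum t n n).pow_const 2).ennreal_ofReal.aemeasurable
  refine (meas_ge_le_lintegral_div hmeas (by simp [hε.ne']) ENNReal.ofReal_ne_top).trans ?_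
  rw [← ofReal_integral_eq_lintegral_ofReal (memLp_two_centredQuadSum t n n).integrable_sq
    (ae_of_all _ fun ω => sq_nonneg _), integral_sq_centredQuadSum,
    ← ENNReal.ofReal_div_of_pos (by positivity)]

/-- **Almost sure dyadic quadratic variation of Brownian motion**: along the dyadic grids,
`∑_{k<2^m} (B_{(k+1)t/2^m} - B_{kt/2^m})² → t` for almost every path (Chebyshev gives
`P(|S_{2^m}| ≥ ε) ≤ 2t²/(ε² 2^m)`, summable in `m`; Borel–Cantelli). Revuz–Yor (1999), Ch. I
Thm (2.4); Doob, *Stochastic Processes* (1953), Ch. VIII §2. [folklore] -/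
theorem ae_tendsto_brownianQuadSum_dyadic (t : ℝ≥0) :
    ∀ᵐ ω ∂preWienerMeasure, Tendsto (fun m : ℕ => brownianQuadSum t (2 ^ m) ω) atTop (𝓝 (t : ℝ)) := by
  -- for each `j`, a.s. eventually `|S_{2^m}| < 1/(j+1)`
  have hj : ∀ j : ℕ, ∀ᵐ ω ∂preWienerMeasure, ∀ᶠ m : ℕ in atTop,
      ω ∉ {ω | (1 : ℝ) / (j + 1) ≤ |centredQuadSum t (2 ^ m) (2 ^ m) ω|} := by
    intro j
    refine ae_eventually_notMem ?_
    have hε : (0 : ℝ) < 1 / (j + 1) := by positivity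
    set C : ℝ := 2 * (t : ℝ) ^ 2 * ((j : ℝ) + 1) ^ 2 with hC
    have hC0 : 0 ≤ C := by positivity
    have hbound : ∀ m : ℕ, preWienerMeasure {ω | (1 : ℝ) / (j + 1) ≤ |centredQuadSum t (2 ^ m) (2 ^ m) ω|} ≤
        ENNReal.ofReal (C * (1 / 2) ^ m) := by
      intro m
      refine (measure_le_abs_centredQuadSum_le t (2 ^ m) hε).trans (le_of_eq ?_)
      congr 1
      have h2 : (2 : ℝ) ^ m ≠ 0 := by positivity
      rw [hC, Nat.cast_pow, Nat.cast_ofNat]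
      have h3 : ((1 : ℝ) / 2) ^ m * 2 ^ m = 1 := by rw [← mul_pow]; norm_num
      field_simp
      linear_combination (-(↑t : ℝ) ^ 2) * h3
    have hsum : Summable fun m : ℕ => C * (1 / 2 : ℝ) ^ m := summable_geometric_two.mul_left C
    refine ne_of_lt (lt_of_le_of_lt (ENNReal.tsum_le_tsum hbound) ?_)
    rw [← ENNReal.ofReal_tsum_of_nonneg (fun m => by positivity) hsum]
    exact ENNReal.ofReal_lt_top
  rw [← ae_all_iff] at hj
  filter_upwards [hj] with ω hω
  have h0 : Tendsto (fun m : ℕ => centredQuadSum t (2 ^ m) (2 ^ m) ω) atTop (𝓝 0) := by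
    rw [Metric.tendsto_atTop]
    intro ε hε
    obtain ⟨j, hj'⟩ := exists_nat_one_div_lt hε
    obtain ⟨M, hM⟩ := eventually_atTop.1 (hω j)
    refine ⟨M, fun m hm => ?_⟩
    have h := hM m hm
    simp only [not_le] at h
    rw [Real.dist_eq, sub_zero]
    exact h.trans hj'
  have heq : ∀ m : ℕ, brownianQuadSum t (2 ^ m) ω = centredQuadSum t (2 ^ m) (2 ^ m) ω + t := fun m => by
    rw [← brownianQuadSum_sub_eq t (pow_ne_zero m two_ne_zero) ω]; ring
  simp_rw [heq]
  simpa using h0.add_const (t : ℝ)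

/-! ### Gaussian exponential moments of the pair at a fixed time -/

/-- `E exp(u B_h) = exp(u² h / 2)` for the canonical Brownian motion (`B_h ∼ 𝓝(0, h)`, Mathlib's
`mgf_gaussianReal`). Revuz–Yor (1999), Ch. I §1. [folklore] -/
theorem integral_exp_mul_brownian (h : ℝ≥0) (u : ℝ) :
    ∫ ω, Real.exp (u * brownian h ω) ∂preWienerMeasure = Real.exp (u ^ 2 * h / 2) := by
  have hlaw := (RandomPlanarGeometry.isPreBrownianReal_brownian.hasLaw_eval h).map_eq
  have := mgf_gaussianReal hlaw u
  rw [mgf] at this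
  rw [this]
  congr 1
  ring

/-- `exp(u B_h)` is integrable. [folklore] -/
theorem integrable_exp_mul_brownian (h : ℝ≥0) (u : ℝ) :
    Integrable (fun ω => Real.exp (u * brownian h ω)) preWienerMeasure := by
  have hlaw := (RandomPlanarGeometry.isPreBrownianReal_brownian.hasLaw_eval h).map_eq
  have hi : Integrable (fun x => Real.exp (u * x)) (preWienerMeasure.map (brownian h)) := by
    rw [hlaw]; exact integrable_exp_mul_gaussianReal u
  exact (integrable_map_measure (by fun_prop) (measurable_brownian h).aemeasurable).1 hi

/-- **`E exp(u B¹_h + v B²_h) = exp((u² + v²) h / 2)`** on the pair space (independent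
coordinates: the product measure factorises). Revuz–Yor (1999), Ch. I §1. [folklore] -/
theorem integral_exp_linear_pair (h : ℝ≥0) (u v : ℝ) :
    ∫ ω : WienerPair, Real.exp (u * brownian h ω.1 + v * brownian h ω.2) ∂wienerPair =
      Real.exp ((u ^ 2 + v ^ 2) * h / 2) := by
  haveI := RandomPlanarGeometry.isProbabilityMeasure_preWienerMeasure'
  simp_rw [Real.exp_add]
  rw [wienerPair, integral_prod_mul (μ := preWienerMeasure) (ν := preWienerMeasure)
    (fun ω₁ => Real.exp (u * brownian h ω₁)) (fun ω₂ => Real.exp (v * brownian h ω₂)),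
    integral_exp_mul_brownian, integral_exp_mul_brownian, ← Real.exp_add]
  congr 1
  ring

/-- `exp(u B¹_h + v B²_h)` is integrable on the pair space. [folklore] -/
theorem integrable_exp_linear_pair (h : ℝ≥0) (u v : ℝ) :
    Integrable (fun ω : WienerPair => Real.exp (u * brownian h ω.1 + v * brownian h ω.2)) wienerPair := by
  haveI := RandomPlanarGeometry.isProbabilityMeasure_preWienerMeasure'
  simp_rw [Real.exp_add]
  rw [wienerPair]
  exact (integrable_exp_mul_brownian h u).mul_prod (integrable_exp_mul_brownian h v)

/-- **The one-step exponential martingale identity**: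
`E exp(u B¹_h + v B²_h - (u² + v²) h / 2) = 1`, as a Lebesgue integral. [folklore] -/
theorem lintegral_exp_linear_pair_sub (h : ℝ≥0) (u v : ℝ) :
    ∫⁻ ω : WienerPair, ENNReal.ofReal
        (Real.exp (u * brownian h ω.1 + v * brownian h ω.2 - (u ^ 2 + v ^ 2) * h / 2)) ∂wienerPair = 1 := by
  have hint : Integrable (fun ω : WienerPair =>
      Real.exp (u * brownian h ω.1 + v * brownian h ω.2 - (u ^ 2 + v ^ 2) * h / 2)) wienerPair := by
    simp_rw [Real.exp_sub]
    exact (integrable_exp_linear_pair h u v).div_const _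
  rw [← ofReal_integral_eq_lintegral_ofReal hint (ae_of_all _ fun ω => (Real.exp_pos _).le)]
  simp_rw [Real.exp_sub]
  rw [integral_div, integral_exp_linear_pair, div_self (Real.exp_pos _).ne', ENNReal.ofReal_one]

/-! ### The coordinates before time `s` are measurable with respect to the past of the pair -/

/-- For `u ≤ s`, `B¹_u` is `σ(pairPast s)`-measurable. [folklore] -/
theorem measurable_comap_pairPast_brownian_fst {s u : ℝ≥0} (hu : u ≤ s) :
    Measurable[MeasurableSpace.comap (pairPast s) inferInstance] fun ω : WienerPair => brownian u ω.1 := by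
  have hfun : (fun ω : WienerPair => brownian u ω.1) =
      (fun q : (Set.Iic s → ℝ) × (Set.Iic s → ℝ) => q.1 ⟨u, hu⟩) ∘ pairPast s := by
    funext ω; rfl
  rw [hfun]
  exact ((measurable_pi_apply _).comp measurable_fst).comp (comap_measurable (pairPast s))

/-- For `u ≤ s`, `B²_u` is `σ(pairPast s)`-measurable. [folklore] -/
theorem measurable_comap_pairPast_brownian_snd {s u : ℝ≥0} (hu : u ≤ s) :
    Measurable[MeasurableSpace.comap (pairPast s) inferInstance] fun ω : WienerPair => brownian u ω.2 := by
  have hfun : (fun ω : WienerPair => brownian u ω.2) =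
      (fun q : (Set.Iic s → ℝ) × (Set.Iic s → ℝ) => q.2 ⟨u, hu⟩) ∘ pairPast s := by
    funext ω; rfl
  rw [hfun]
  exact ((measurable_pi_apply _).comp measurable_snd).comp (comap_measurable (pairPast s))

/-- Transfer of an almost sure property of single paths to each coordinate of the pair. [folklore] -/
theorem ae_wienerPair_fst {p : (ℝ≥0 → ℝ) → Prop} (hp : ∀ᵐ ω₁ ∂preWienerMeasure, p ω₁) :
    ∀ᵐ ω ∂wienerPair, p ω.1 := by
  rw [wienerPair]
  have : (preWienerMeasure.prod preWienerMeasure).map Prod.fst = preWienerMeasure := by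
    haveI := RandomPlanarGeometry.isProbabilityMeasure_preWienerMeasure'
    exact Measure.map_fst_prod.trans (by simp)
  have h2 : ∀ᵐ ω ∂(preWienerMeasure.prod preWienerMeasure).map Prod.fst, p ω := by rwa [this]
  exact ae_of_ae_map measurable_fst.aemeasurable h2

/-- Transfer of an almost sure property of single paths to the second coordinate. [folklore] -/
theorem ae_wienerPair_snd {p : (ℝ≥0 → ℝ) → Prop} (hp : ∀ᵐ ω₂ ∂preWienerMeasure, p ω₂) :
    ∀ᵐ ω ∂wienerPair, p ω.2 := by
  rw [wienerPair]
  have : (preWienerMeasure.prod preWienerMeasure).map Prod.snd = preWienerMeasure := by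
    haveI := RandomPlanarGeometry.isProbabilityMeasure_preWienerMeasure'
    exact Measure.map_snd_prod.trans (by simp)
  have h2 : ∀ᵐ ω ∂(preWienerMeasure.prod preWienerMeasure).map Prod.snd, p ω := by rwa [this]
  exact ae_of_ae_map measurable_snd.aemeasurable h2

/-- **Dyadic quadratic variation of both coordinates of the pair**, almost surely. [folklore] -/
theorem ae_tendsto_brownianQuadSum_dyadic_pair (t : ℝ≥0) :
    ∀ᵐ ω ∂wienerPair, Tendsto (fun m : ℕ => brownianQuadSum t (2 ^ m) ω.1) atTop (𝓝 (t : ℝ)) ∧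
      Tendsto (fun m : ℕ => brownianQuadSum t (2 ^ m) ω.2) atTop (𝓝 (t : ℝ)) := by
  filter_upwards [ae_wienerPair_fst (ae_tendsto_brownianQuadSum_dyadic t),
    ae_wienerPair_snd (ae_tendsto_brownianQuadSum_dyadic t)] with ω h1 h2
  exact ⟨h1, h2⟩

end Literature.Probability.Process
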